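import Literature.Probability.Percolation.QuadCrossingSpace
import HarnessLib

/-!
# The polar half-annulus quad (support file for the undocked half-plane three-arm reduction)

Serves the registered stub `stub_noTouch_undockedThreeArm` of crux stmt-CriticalPhenomena-10268
(line `hitting-tournament`) through its conditional form: the continuum duality step of the
reduction of the cluster-form half-plane three-arm bound to the undocked half-plane two-arm
bound runs in the closed half-annulus `{a ≤ |z - c| ≤ b, Im c ≤ Im z}`, realised here as a
Schramm–Smirnov quad by polar coordinates `(θ, s) ↦ c + (a + s (b - a)) e^{iπθ}`:

* `stub_undockedThreeArm_polarQuad` — for `0 < a < b` there is a quad `Q` with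
  `[Q] = {a ≤ dist z c ≤ b, c.im ≤ z.im}`, `∂₁Q = {dist z c = a, c.im ≤ z.im}` (inner
  semicircle) and `∂₃Q = {dist z c = b, c.im ≤ z.im}` (outer semicircle); the remaining sides
  `∂₀Q`, `∂₂Q` are the two boundary segments on the line `Im z = Im c`.

No definition is introduced (the parametrisation is local to the proof).

References: O. Schramm, S. Smirnov, Ann. Probab. 39 (2011), §1.3 (quads) [SchrammSmirnov2011].
-/

noncomputable section

open Set Metric Complex
open scoped unitInterval
open Literature.Probability.Percolation Literature.Probability.Percolation.QuadCrossing

namespace Summit.CriticalPhenomena.CardyFormulaZ2.Cruxes.LagHandOff.HittingTournament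

/-- **The polar half-annulus quad.** For `0 < a < b` and any centre `c` there is a
Schramm–Smirnov quad `Q` (in `D = ℂ`) whose carrier is the closed upper half-annulus
`{a ≤ dist z c ≤ b, c.im ≤ z.im}`, with `∂₁Q` the inner semicircle `{dist z c = a, c.im ≤ z.im}`
and `∂₃Q` the outer semicircle `{dist z c = b, c.im ≤ z.im}` (polar coordinates
`(θ, s) ↦ c + (a + s (b - a)) e^{iπθ}`: continuous, injective since the radius is read off the
distance to `c` and the angle `πθ ∈ [0, π]` off the exponential, onto by `z - c = |z - c| e^{i arg}`
with `arg (z - c) ∈ [0, π]` when `Im c ≤ Im z`). [cite: SchrammSmirnov2011, §1.3 (quads)] -/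
theorem stub_undockedThreeArm_polarQuad : ∀ (c : ℂ) (a b : ℝ), 0 < a → a < b →
    ∃ Q : Quad (Set.univ : Set ℂ), Q.carrier = {z : ℂ | a ≤ dist z c ∧ dist z c ≤ b ∧ c.im ≤ z.im} ∧
      Q.side 1 = {z : ℂ | dist z c = a ∧ c.im ≤ z.im} ∧
      Q.side 3 = {z : ℂ | dist z c = b ∧ c.im ≤ z.im} := by
  intro c a b ha hab
  have hpi := Real.pi_pos
  have hba : (b - a) ≠ 0 := by linarith
  -- the polar parametrisation
  set f : I × I → ℂ := fun p =>
    c + ((a + (p.2 : ℝ) * (b - a) : ℝ) : ℂ) * exp ((Real.pi * (p.1 : ℝ) : ℝ) * Complex.I) with hf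
  have radius_mem : ∀ s : I,
      a ≤ a + (s : ℝ) * (b - a) ∧ a + (s : ℝ) * (b - a) ≤ b ∧ 0 < a + (s : ℝ) * (b - a) := fun s => by
    have h0 : (0 : ℝ) ≤ s := s.2.1
    have h1 : (s : ℝ) ≤ 1 := s.2.2
    exact ⟨by nlinarith, by nlinarith, by nlinarith⟩
  have dist_f : ∀ p, dist (f p) c = a + (p.2 : ℝ) * (b - a) := fun p => by
    obtain ⟨-, -, hpos⟩ := radius_mem p.2
    rw [dist_eq_norm, hf]
    dsimp only
    rw [add_sub_cancel_left, norm_mul, norm_exp_ofReal_mul_I, mul_one, norm_real, Real.norm_eq_abs,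
      abs_of_pos hpos]
  have im_f : ∀ p, c.im ≤ (f p).im := fun p => by
    obtain ⟨-, -, hpos⟩ := radius_mem p.2
    have hsin : 0 ≤ Real.sin (Real.pi * (p.1 : ℝ)) :=
      Real.sin_nonneg_of_nonneg_of_le_pi (by nlinarith [p.1.2.1]) (by nlinarith [p.1.2.2])
    rw [hf]
    dsimp only
    rw [add_im, exp_mul_I]
    simp only [mul_im, ofReal_re, ofReal_im, add_im, cos_ofReal_im, sin_ofReal_im, mul_zero,
      add_zero, zero_mul, sin_ofReal_re, I_re, I_im, mul_one, zero_add, le_add_iff_nonneg_right]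
    positivity
  -- polar form of a point of the closed upper half-annulus
  have polar : ∀ z : ℂ, a ≤ dist z c → dist z c ≤ b → c.im ≤ z.im →
      ∃ p : I × I, f p = z ∧ a + (p.2 : ℝ) * (b - a) = dist z c := fun z haz hzb him => by
    set w : ℂ := z - c with hw
    have hwn : ‖w‖ = dist z c := by rw [hw, dist_eq_norm]
    have hwim : 0 ≤ w.im := by rw [hw, sub_im]; linarith
    have harg0 : 0 ≤ arg w := arg_nonneg_iff.2 hwim
    have hargπ : arg w ≤ Real.pi := arg_le_pi w
    set θ : ℝ := arg w / Real.pi with hθ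
    have hθ0 : 0 ≤ θ := div_nonneg harg0 hpi.le
    have hθ1 : θ ≤ 1 := by rw [hθ, div_le_one hpi]; exact hargπ
    set s : ℝ := (dist z c - a) / (b - a) with hs
    have hba' : 0 < b - a := by linarith
    have hs0 : 0 ≤ s := div_nonneg (by linarith) hba'.le
    have hs1 : s ≤ 1 := by rw [hs, div_le_one hba']; linarith
    refine ⟨(⟨θ, hθ0, hθ1⟩, ⟨s, hs0, hs1⟩), ?_, ?_⟩
    · have hrad : a + s * (b - a) = ‖w‖ := by rw [hwn, hs]; field_simp; ring
      have hang : Real.pi * θ = arg w := by rw [hθ]; field_simp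
      show c + ((a + s * (b - a) : ℝ) : ℂ) * exp ((Real.pi * θ : ℝ) * Complex.I) = z
      rw [hrad, hang, norm_mul_exp_arg_mul_I, hw, add_sub_cancel]
    · show a + s * (b - a) = dist z c
      rw [hs]; field_simp; ring
  -- injectivity
  have hinj : Function.Injective f := by
    intro p q hpq
    obtain ⟨-, -, hp⟩ := radius_mem p.2
    obtain ⟨-, -, hq⟩ := radius_mem q.2
    have hdist : a + (p.2 : ℝ) * (b - a) = a + (q.2 : ℝ) * (b - a) := by
      rw [← dist_f p, ← dist_f q, hpq]
    have h2 : (p.2 : ℝ) = q.2 := mul_right_cancel₀ hba (by linarith)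
    have hexp : exp ((Real.pi * (p.1 : ℝ) : ℝ) * Complex.I) =
        exp ((Real.pi * (q.1 : ℝ) : ℝ) * Complex.I) := by
      have h := hpq
      rw [hf] at h
      dsimp only at h
      rw [hdist, add_right_inj] at h
      exact mul_left_cancel₀ (Complex.ofReal_ne_zero.2 hq.ne') h
    obtain ⟨n, hn⟩ := exp_eq_exp_iff_exists_int.1 hexp
    have hre := congrArg Complex.im hn
    simp only [mul_im, ofReal_re, I_im, mul_one, ofReal_im, I_re, mul_zero, add_zero, add_im,
      mul_re, intCast_re, re_ofNat, intCast_im, im_ofNat, sub_zero, zero_mul] at hre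
    have h1 : (p.1 : ℝ) = q.1 + 2 * n := by
      have : Real.pi * (p.1 : ℝ) = Real.pi * (q.1 + 2 * n) := by rw [hre]; ring
      exact mul_left_cancel₀ hpi.ne' this
    have hn0 : (n : ℝ) = 0 := by
      have hp0 := p.1.2.1; have hp1 := p.1.2.2; have hq0 := q.1.2.1; have hq1 := q.1.2.2
      have hlt : |(n : ℝ)| < 1 := by rw [abs_lt]; constructor <;> linarith
      have habs : |n| < 1 := by exact_mod_cast hlt
      have hn : n = 0 := by rw [abs_lt] at habs; omega
      exact_mod_cast hn
    have h1' : (p.1 : ℝ) = q.1 := by rw [h1, hn0]; ring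
    exact Prod.ext (Subtype.ext h1') (Subtype.ext h2)
  have hcont : Continuous f := by rw [hf]; fun_prop
  let Q : Quad (Set.univ : Set ℂ) :=
    { toFun := f
      continuous_toFun := hcont
      injective_toFun := hinj
      range_subset := subset_univ _ }
  have hQ : ∀ p, Q p = f p := fun p => rfl
  refine ⟨Q, ?_, ?_, ?_⟩
  · ext z
    constructor
    · rintro ⟨p, rfl⟩
      obtain ⟨h1, h2, -⟩ := radius_mem p.2
      rw [mem_setOf_eq, hQ, dist_f]
      exact ⟨h1, h2, im_f p⟩
    · rintro ⟨haz, hzb, him⟩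
      obtain ⟨p, hp, -⟩ := polar z haz hzb him
      exact ⟨p, hp⟩
  · show Q '' {p | p.2 = 0} = _
    ext z
    constructor
    · rintro ⟨p, hp, rfl⟩
      have hp' : (p.2 : ℝ) = 0 := by rw [show p.2 = 0 from hp]; rfl
      rw [mem_setOf_eq, hQ, dist_f, hp']
      exact ⟨by ring, im_f p⟩
    · rintro ⟨hza, him⟩
      obtain ⟨p, hp, hrad⟩ := polar z hza.ge (by linarith) him
      refine ⟨p, ?_, hp⟩
      have : (p.2 : ℝ) = 0 := by
        have : (p.2 : ℝ) * (b - a) = 0 := by linarith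
        exact (mul_eq_zero.1 this).resolve_right hba
      exact Subtype.ext this
  · show Q '' {p | p.2 = 1} = _
    ext z
    constructor
    · rintro ⟨p, hp, rfl⟩
      have hp' : (p.2 : ℝ) = 1 := by rw [show p.2 = 1 from hp]; rfl
      rw [mem_setOf_eq, hQ, dist_f, hp']
      exact ⟨by ring, im_f p⟩
    · rintro ⟨hzb, him⟩
      obtain ⟨p, hp, hrad⟩ := polar z (by linarith) hzb.le him
      refine ⟨p, ?_, hp⟩
      have : (p.2 : ℝ) = 1 := by
        have : ((p.2 : ℝ) - 1) * (b - a) = 0 := by linarith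
        have := (mul_eq_zero.1 this).resolve_right hba
        linarith
      exact Subtype.ext this

end Summit.CriticalPhenomena.CardyFormulaZ2.Cruxes.LagHandOff.HittingTournament
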